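import Literature.NumberTheory.Sieve.Maynard2016Prop92Decomposition
import Literature.NumberTheory.Sieve.FGKMT2018DkBoxClasses
import Literature.NumberTheory.Sieve.FGKMT2018LocalPairSumTotal
import Literature.NumberTheory.LFunctions.Zhang2022.Section8ArithmeticIdentity
import HarnessLib

/-!
# Maynard 2016, Proposition 9.2 for `𝒜 = ℤ` — support restriction and the residue classes (p. 21)

Source: J. Maynard, *Dense clusters of primes in subsets*, Compositio Math. 152 (2016) =
arXiv:1405.2593 [Maynard2016DenseClusters], proof of Proposition 9.2, p. 21, displays (9.6)–(9.9):

«We first fix one of the forms `L = L_m`, split the sum into residue classes `n ≡ v₀ (mod W)`, expand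
`w_n = (∑_{d_i ∣ L_i(n)} λ_d)²` and swap the order of summation … If `p ∣ d_j` and `p ∣ a_j b_m − a_m b_j`
then `[d_j, e_j] ∣ L_j(n)` forces `p ∣ a_j L_m(n)`; `p ∤ a_j` by admissibility, so `p ∣ L_m(n)`, which
is impossible for `L_m(n)` prime since `d_j < R < L(n)`. Hence there is no contribution from `λ_d` with
`(d_j, a_j b_m − a_m b_j) ≠ 1`, and similarly none unless `d_m = e_m = 1` … By the Chinese remainder
theorem the inner sum is `#𝒫_{L,𝒜}(x; q, a)` summed over the admissible classes `a (mod q)`,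
`q = W[d, e]`, each with `(L(a), q) = 1`, so `#𝒫_{L,𝒜}(x;q,a) = #𝒫_{L,𝒜}(x)/φ_L(q) + O(E_q^{(2)})`.»

This file proves, for `𝒜 = ℤ` and the typed data of `FGKMT2018MultidimensionalSieve` /
`Maynard2016Prop92Decomposition` (`dkBoxP`, `crossDet`, `primeQF`, `totForm`):
* `mem_dkBoxP_of_dvd_prime` — the support restriction: a `d ∈ 𝒟_k` whose coordinates divide the
  `L_i(n)` at an `n` with `L_m(n) > R` prime lies in `𝒟'_k ∩ {d_m = 1}`;
* `card_filter_periodic_eq_sum_classes` — splitting a count over the residue classes of a periodic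
  condition; `sum_prime_sieveWt_eq_classes` — the expansion of `∑_n 1_𝒫(L_m(n)) w_n` as
  `∑'_{d,e ∈ 𝒟'_k, d_m=e_m=1} λ_d λ_e ∑_{classes c mod q} #𝒫_{L_m}(X; q, c)`, `q = W ∏[d_i,e_i]`,
  with exactly `φ_ω(W)` classes (`card_classes_eq`), each coprime (`intGcd_formEval_eq_one_of_mem_classes`);
* `totForm_mul_of_coprime` — `φ_L(mn) = φ_L(m) φ_L(n)` for `(m, n) = 1`;
* `sum_prime_sieveWt_eq_main_add_error` — the exact main + error split
  `∑_n 1_𝒫(L_m(n)) w_n = φ_ω(W) #𝒫_{L_m}(X)/φ_L(W) · Q_m + ∑' λ_d λ_e ∑_c (#𝒫(X;q,c) − #𝒫(X)/φ_L(q))`.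

## References
* J. Maynard, *Dense clusters of primes in subsets*, Compositio Math. 152 (2016), proof of Prop. 9.2
  p. 21 [Maynard2016DenseClusters].
* K. Ford, B. Green, S. Konyagin, J. Maynard, T. Tao, *Long gaps between primes*, JAMS 31 (2018),
  Theorem 6 (7.13), Hypothesis 1 (2) p. 20 [FordGreenKonyaginMaynardTao2018].
-/

noncomputable section

open Finset Filter

namespace Literature.NumberTheory.Sieve.FGKMT2018

variable {k : ℕ}

/-! ### The cross determinant and the support restriction -/

/-- `a_j L_m(n) − a_m L_j(n) = a_j b_m − a_m b_j`. [cite: Maynard2016DenseClusters, proof of Prop. 9.2 p. 21 («a_j L_m(n) − a_m L_j(n) = a_j b_m − a_m b_j»)] -/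
theorem fst_mul_formEval_sub (L : Fin k → ℤ × ℤ) (m j : Fin k) (n : ℤ) :
    (L j).1 * formEval (L m) n - (L m).1 * formEval (L j) n = crossDet L m j := by
  unfold formEval crossDet; ring

/-- Membership in `dkBoxP` unfolded. [cite: Maynard2016DenseClusters, proof of Prop. 9.2 p. 21, display (9.7)] -/
theorem mem_dkBoxP_iff {L : Fin k → ℤ × ℤ} {B : ℕ} {R : ℝ} {m : Fin k} {d : Fin k → ℕ} :
    d ∈ dkBoxP L B R m ↔ d ∈ dkBox L B R ∧ d m = 1 ∧
      ∀ j, j ≠ m → Nat.Coprime (d j) (crossDet L m j).natAbs := by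
  unfold dkBoxP; rw [Finset.mem_filter]

/-- `𝒟'_k ∩ {d_m = 1} ⊆ 𝒟_k`. [cite: Maynard2016DenseClusters, §6 p. 11 («𝒟'_k(𝓛) ⊆ 𝒟_k(𝓛)»)] -/
theorem dkBoxP_subset (L : Fin k → ℤ × ℤ) (B : ℕ) (R : ℝ) (m : Fin k) :
    dkBoxP L B R m ⊆ dkBox L B R := by
  unfold dkBoxP; exact Finset.filter_subset _ _

/-- A natural number `d ≤ ⌊R⌋` dividing a prime `ℓ > R` (as an integer) equals `1`.
[cite: Maynard2016DenseClusters, proof of Prop. 9.2 p. 21 («since d_j < R < L(n)»)] -/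
theorem eq_one_of_dvd_prime_gt {d : ℕ} {R : ℝ} {ℓ : ℤ} (hdR : d ≤ ⌊R⌋₊) (hd1 : 1 ≤ d)
    (hℓ : 0 < ℓ) (hprime : ℓ.natAbs.Prime) (hRℓ : R < (ℓ : ℝ)) (hdvd : (d : ℤ) ∣ ℓ) : d = 1 := by
  have hdvd' : d ∣ ℓ.natAbs := Int.natCast_dvd.1 hdvd
  rcases (Nat.dvd_prime hprime).1 hdvd' with h | h
  · exact h
  · exfalso
    have hR1 : 1 ≤ R := by
      have : 0 < ⌊R⌋₊ := lt_of_lt_of_le Nat.one_pos (hd1.trans hdR)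
      exact (Nat.floor_pos.1 this)
    have hdle : (d : ℝ) ≤ R := le_trans (by exact_mod_cast hdR) (Nat.floor_le (by linarith))
    have hℓeq : (ℓ : ℝ) = (ℓ.natAbs : ℝ) := by
      rw [← Int.cast_natCast (R := ℝ) ℓ.natAbs, Int.natAbs_of_nonneg hℓ.le]
    rw [hℓeq, ← h] at hRℓ
    exact absurd hRℓ (not_lt.2 hdle)

/-- **The support restriction** of the proof of Prop. 9.2: if `d ∈ 𝒟_k(𝓛)` (`𝓛` admissible),
`d_i ∣ L_i(n)` for all `i`, and `L_m(n) > R` is prime, then `d_m = 1` and `(d_j, a_j b_m − a_m b_j) = 1`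
for all `j ≠ m`, i.e. `d ∈ dkBoxP`. [cite: Maynard2016DenseClusters, proof of Prop. 9.2 p. 21 («there is no contribution from λ_d with (d_j, a_j b_m − a_m b_j) ≠ 1», «iff d_m = e_m = 1»)] -/
theorem mem_dkBoxP_of_dvd_prime {L : Fin k → ℤ × ℤ} (hadm : FormsAdmissible L) {B : ℕ} {R : ℝ}
    {m : Fin k} {d : Fin k → ℕ} (hd : d ∈ dkBox L B R) {n : ℤ} (hℓ : 0 < formEval (L m) n)
    (hprime : (formEval (L m) n).natAbs.Prime) (hRℓ : R < (formEval (L m) n : ℝ))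
    (hdn : ∀ i, ((d i : ℕ) : ℤ) ∣ formEval (L i) n) : d ∈ dkBoxP L B R m := by
  refine mem_dkBoxP_iff.2 ⟨hd, ?_, ?_⟩
  · exact eq_one_of_dvd_prime_gt (le_floor_of_mem_dkBox hd m) (one_le_of_mem_dkBox hd m) hℓ hprime
      hRℓ (hdn m)
  · intro j hjm
    by_contra hcop
    obtain ⟨p, hp, hpd, hpΔ⟩ := Nat.Prime.not_coprime_iff_dvd.1 hcop
    have hpdj : (p : ℤ) ∣ formEval (L j) n := (Int.natCast_dvd_natCast.2 hpd).trans (hdn j)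
    have hpΔ' : (p : ℤ) ∣ crossDet L m j := Int.natCast_dvd.2 hpΔ
    have hpa : ¬ (p : ℤ) ∣ (L j).1 := not_intDvd_fst_of_dvd_formEval hadm j hp hpdj
    have hprod : (p : ℤ) ∣ (L j).1 * formEval (L m) n := by
      have e : (L j).1 * formEval (L m) n = crossDet L m j + (L m).1 * formEval (L j) n := by
        rw [← fst_mul_formEval_sub L m j n]; ring
      rw [e]; exact dvd_add hpΔ' (hpdj.mul_left _)
    have hpℓ : (p : ℤ) ∣ formEval (L m) n := by
      rcases (Int.Prime.dvd_mul' hp hprod) with h | h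
      · exact absurd h hpa
      · exact h
    have hp1 : p = 1 := by
      refine eq_one_of_dvd_prime_gt ((Nat.le_of_dvd (one_le_of_mem_dkBox hd j) hpd).trans
        (le_floor_of_mem_dkBox hd j)) hp.one_lt.le hℓ hprime hRℓ hpℓ
    exact hp.one_lt.ne' hp1

/-! ### Splitting a count over the residue classes of a periodic condition -/

/-- **Class-by-class splitting.** If `Q` is `q`-periodic (`q ≥ 1`) then
`#{n ∈ S : Q n ∧ P n} = ∑_{0 ≤ c < q, Q c} #{n ∈ S : n ≡ c (mod q) ∧ P n}`.
[cite: Maynard2016DenseClusters, proof of Prop. 9.2 p. 21 («split the sum into residue classes»); FordGreenKonyaginMaynardTao2018, §7 p. 20] -/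
theorem card_filter_periodic_eq_sum_classes (S : Finset ℤ) {q : ℕ} (hq : 0 < q) (P Q : ℤ → Prop)
    [DecidablePred P] [DecidablePred Q] (hQ : ∀ n t : ℤ, Q (n + q * t) ↔ Q n) :
    #(S.filter fun n => Q n ∧ P n) =
      ∑ c ∈ (Finset.range q).filter (fun c : ℕ => Q c),
        #(S.filter fun n => n ≡ (c : ℤ) [ZMOD (q : ℤ)] ∧ P n) := by
  classical
  set N := (Finset.range q).filter fun c : ℕ => Q c with hN
  have hqZ : (q : ℤ) ≠ 0 := by exact_mod_cast hq.ne'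
  have hqZ' : (0 : ℤ) < q := by exact_mod_cast hq
  have hmodQ : ∀ n : ℤ, Q (n % q) ↔ Q n := by
    intro n
    have e : n % q = n + q * (-(n / q)) := by rw [Int.emod_def]; ring
    rw [e]; exact hQ n _
  set f : ℤ → ℕ := fun n => (n % q).toNat with hf
  have hf_cast : ∀ n : ℤ, ((f n : ℕ) : ℤ) = n % q := fun n =>
    Int.toNat_of_nonneg (Int.emod_nonneg n hqZ)
  have hf_lt : ∀ n : ℤ, f n < q := by
    intro n
    have h1 : ((f n : ℕ) : ℤ) < q := by rw [hf_cast]; exact Int.emod_lt_of_pos n hqZ'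
    exact_mod_cast h1
  have Hmap : ∀ n ∈ S.filter (fun n => Q n ∧ P n), f n ∈ N := by
    intro n hn
    refine Finset.mem_filter.2 ⟨Finset.mem_range.2 (hf_lt n), ?_⟩
    rw [hf_cast]
    exact (hmodQ n).2 (Finset.mem_filter.1 hn).2.1
  rw [Finset.card_eq_sum_card_fiberwise Hmap]
  refine Finset.sum_congr rfl fun c hc => ?_
  obtain ⟨hcq, hQc⟩ := Finset.mem_filter.1 hc
  have hcq' : (c : ℤ) % q = c :=
    Int.emod_eq_of_lt (by exact_mod_cast Nat.zero_le c) (by exact_mod_cast Finset.mem_range.1 hcq)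
  congr 1
  ext n
  simp only [Finset.mem_filter]
  constructor
  · rintro ⟨⟨hn, -, hPn⟩, hfn⟩
    refine ⟨hn, ?_, hPn⟩
    show n % q = (c : ℤ) % q
    rw [hcq', ← hf_cast n, hfn]
  · rintro ⟨hn, hmod, hPn⟩
    have e : n % q = c := by rw [hmod.eq, hcq']
    refine ⟨⟨hn, ?_, hPn⟩, ?_⟩
    · rw [← hmodQ n, e]; exact hQc
    · have : ((f n : ℕ) : ℤ) = c := by rw [hf_cast, e]
      exact_mod_cast this

/-! ### The classes of a pair `d, e` -/

/-- The modulus `q = W ∏ᵢ [dᵢ, eᵢ]`. [cite: Maynard2016DenseClusters, proof of Prop. 9.2 p. 21 («q = W[d,e]»)] -/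
def pairMod (B : ℕ) (d e : Fin k → ℕ) : ℕ := wCut k B * ∏ i, Nat.lcm (d i) (e i)

/-- The admissible classes `c (mod q)` of the pair: `(L_i(c), W) = 1` and `[d_i,e_i] ∣ L_i(c)` for all `i`.
[cite: Maynard2016DenseClusters, proof of Prop. 9.2 p. 21 («#𝒫_{L,𝒜}(x; q, a)» over the classes a)] -/
def pairClasses (L : Fin k → ℤ × ℤ) (B : ℕ) (d e : Fin k → ℕ) : Finset ℕ :=
  (Finset.range (pairMod B d e)).filter fun c : ℕ =>
    (∀ i, Int.gcd (formEval (L i) c) (wCut k B) = 1) ∧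
      ∀ i, ((Nat.lcm (d i) (e i) : ℕ) : ℤ) ∣ formEval (L i) c

/-- `q = W∏[dᵢ,eᵢ] > 0`. [cite: Maynard2016DenseClusters, proof of Prop. 9.2 p. 21 («q = W[d,e]»)] -/
theorem pairMod_pos {L : Fin k → ℤ × ℤ} {B : ℕ} {R : ℝ} {d e : Fin k → ℕ} (hd : d ∈ dkBox L B R)
    (he : e ∈ dkBox L B R) : 0 < pairMod B d e :=
  Nat.mul_pos (Nat.pos_of_ne_zero (squarefree_wCut k B).ne_zero) (Finset.prod_pos fun i _ =>
    Nat.lcm_pos (one_le_of_mem_dkBox hd i) (one_le_of_mem_dkBox he i))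

/-- **Exactly `φ_ω(W)` classes** for a cross-coprime pair `d, e ∈ 𝒟_k(𝓛)`.
[cite: Maynard2016DenseClusters, proof of Prop. 9.2 p. 23 («Summing over the φ_ω(W) residue classes»), Prop. 9.1 p. 19] -/
theorem card_pairClasses_eq {L : Fin k → ℤ × ℤ} (hadm : FormsAdmissible L) {B : ℕ} {R : ℝ}
    {d e : Fin k → ℕ} (hd : d ∈ dkBox L B R) (he : e ∈ dkBox L B R)
    (hcross : Pairwise fun i j => (d i * e i).Coprime (d j * e j)) :
    (#(pairClasses L B d e) : ℝ) = phiOmega L (wCut k B) := by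
  classical
  have hm : ∀ ι, 0 < Nat.lcm (d ι) (e ι) :=
    fun ι => Nat.lcm_pos (one_le_of_mem_dkBox hd ι) (one_le_of_mem_dkBox he ι)
  have hmW : ∀ ι, (Nat.lcm (d ι) (e ι)).Coprime (wCut k B) := fun ι =>
    Nat.Coprime.coprime_dvd_left (Nat.lcm_dvd_mul _ _)
      (Nat.Coprime.mul_left (coprime_apply_wCut_of_mem_dkBox hd ι)
        (coprime_apply_wCut_of_mem_dkBox he ι))
  have hmm : Pairwise fun i j => (Nat.lcm (d i) (e i)).Coprime (Nat.lcm (d j) (e j)) :=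
    fun i j hij => Nat.Coprime.coprime_dvd_left (Nat.lcm_dvd_mul _ _)
      (Nat.Coprime.coprime_dvd_right (Nat.lcm_dvd_mul _ _) (hcross hij))
  have ham : ∀ ι, Int.gcd (L ι).1 (Nat.lcm (d ι) (e ι)) = 1 :=
    fun ι => intGcd_fst_lcm_eq_one_of_mem_dkBox hadm hd he ι
  have h := card_range_filter_localSystem L (squarefree_wCut k B) (fun ι => Nat.lcm (d ι) (e ι))
    hm hmW hmm ham
  unfold pairClasses pairMod
  rw [h, cast_prod_sub_omegaL]

/-- **Every admissible class is coprime to the modulus**: for `d, e ∈ 𝒟'_k` with `d_m = e_m = 1` and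
`c` an admissible class, `(L_m(c), q) = 1` («`#𝒫_{L,𝒜}(x;q,a)` … iff `(L(a), q) = 1`»).
[cite: Maynard2016DenseClusters, proof of Prop. 9.2 p. 21] -/
theorem intGcd_formEval_eq_one_of_mem_pairClasses {L : Fin k → ℤ × ℤ} {B : ℕ} {R : ℝ} {m : Fin k}
    {d e : Fin k → ℕ} (hd : d ∈ dkBoxP L B R m) (he : e ∈ dkBoxP L B R m) {c : ℕ}
    (hc : c ∈ pairClasses L B d e) : Int.gcd (formEval (L m) c) (pairMod B d e) = 1 := by
  classical
  obtain ⟨hdB, hdm, hdΔ⟩ := mem_dkBoxP_iff.1 hd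
  obtain ⟨heB, hem, heΔ⟩ := mem_dkBoxP_iff.1 he
  obtain ⟨-, hW, hdvd⟩ := Finset.mem_filter.1 (show c ∈ pairClasses L B d e from hc)
  apply Int.isCoprime_iff_gcd_eq_one.1
  unfold pairMod
  push_cast
  refine IsCoprime.mul_right ?_ (IsCoprime.prod_right fun j _ => ?_)
  · exact Int.isCoprime_iff_gcd_eq_one.2 (hW m)
  · by_cases hjm : j = m
    · subst hjm; rw [hdm, hem]; simpa using isCoprime_one_right
    · rw [Int.isCoprime_iff_gcd_eq_one, Int.gcd_eq_natAbs, Int.natAbs_natCast]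
      by_contra hne
      obtain ⟨p, hp, hpℓ, hpl⟩ := Nat.Prime.not_coprime_iff_dvd.1 hne
      have hpL : (p : ℤ) ∣ formEval (L m) c := Int.natCast_dvd.2 hpℓ
      have hpj : (p : ℤ) ∣ formEval (L j) c := (Int.natCast_dvd_natCast.2 hpl).trans (hdvd j)
      have hpΔ : (p : ℤ) ∣ crossDet L m j := by
        rw [← fst_mul_formEval_sub L m j c]
        exact dvd_sub (hpL.mul_left _) (hpj.mul_left _)
      have hpΔ' : p ∣ (crossDet L m j).natAbs := Int.natCast_dvd.1 hpΔ
      rcases (Nat.Prime.dvd_mul hp).1 (hpl.trans (Nat.lcm_dvd_mul (d j) (e j))) with h | h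
      · exact (Nat.Prime.not_coprime_iff_dvd.2 ⟨p, hp, h, hpΔ'⟩) (hdΔ j hjm)
      · exact (Nat.Prime.not_coprime_iff_dvd.2 ⟨p, hp, h, hpΔ'⟩) (heΔ j hjm)

/-- **The count of a cross-coprime pair split over its classes**:
`#{n ∈ 𝒜(X) : L_m(n) prime, (L_i(n),W)=1, d_i, e_i ∣ L_i(n) ∀i} = ∑_{c ∈ classes} #𝒫_{L_m}(X; q, c)`.
[cite: Maynard2016DenseClusters, proof of Prop. 9.2 p. 21 («the inner sum is #𝒫_{L,𝒜}(x;q,a)»)] -/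
theorem card_prime_pair_eq_sum_classes (X : ℝ) (L : Fin k → ℤ × ℤ) {B : ℕ} {R : ℝ} (m : Fin k)
    {d e : Fin k → ℕ} (hd : d ∈ dkBox L B R) (he : e ∈ dkBox L B R) :
    #(((dyadZ X).filter fun n => 0 < formEval (L m) n ∧ (formEval (L m) n).natAbs.Prime).filter
        fun n => (∀ i, Int.gcd (formEval (L i) n) (wCut k B) = 1) ∧
          (∀ i, ((d i : ℕ) : ℤ) ∣ formEval (L i) n) ∧ ∀ i, ((e i : ℕ) : ℤ) ∣ formEval (L i) n) =
      ∑ c ∈ pairClasses L B d e, primeCountZMod (L m) X (pairMod B d e) c := by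
  classical
  have hq := pairMod_pos hd he
  set Q : ℤ → Prop := fun n => (∀ i, Int.gcd (formEval (L i) n) (wCut k B) = 1) ∧
      ∀ i, ((Nat.lcm (d i) (e i) : ℕ) : ℤ) ∣ formEval (L i) n with hQdef
  have hper : ∀ n t : ℤ, Q (n + (pairMod B d e : ℕ) * t) ↔ Q n := by
    intro n t
    refine and_congr (forall_congr' fun i => ?_) (forall_congr' fun i => ?_)
    · have e1 : (n + (pairMod B d e : ℕ) * t) =
          n + (wCut k B : ℕ) * ((∏ i, Nat.lcm (d i) (e i) : ℕ) * t) := by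
        unfold pairMod; push_cast; ring
      rw [e1, formEval_add, show (L i).1 * ((wCut k B : ℤ) * _) =
        (wCut k B : ℕ) * ((L i).1 * ((∏ i, Nat.lcm (d i) (e i) : ℕ) * t)) by ring, intGcd_add_mul_self]
    · obtain ⟨c, hc⟩ : Nat.lcm (d i) (e i) ∣ pairMod B d e :=
        (Finset.dvd_prod_of_mem _ (Finset.mem_univ i)).mul_left (wCut k B)
      have e1 : (n + (pairMod B d e : ℕ) * t) = n + (Nat.lcm (d i) (e i) : ℕ) * ((c : ℤ) * t) := by
        rw [hc]; push_cast; ring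
      rw [e1, dvd_formEval_add_mul]
  have hset : (((dyadZ X).filter fun n => 0 < formEval (L m) n ∧ (formEval (L m) n).natAbs.Prime).filter
      fun n => (∀ i, Int.gcd (formEval (L i) n) (wCut k B) = 1) ∧
        (∀ i, ((d i : ℕ) : ℤ) ∣ formEval (L i) n) ∧ ∀ i, ((e i : ℕ) : ℤ) ∣ formEval (L i) n) =
      (dyadZ X).filter fun n => Q n ∧ (0 < formEval (L m) n ∧ (formEval (L m) n).natAbs.Prime) := by
    rw [Finset.filter_filter]
    refine Finset.filter_congr fun n _ => ?_
    rw [hQdef]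
    constructor
    · rintro ⟨hP, hW, hdd, hee⟩
      exact ⟨⟨hW, fun i => (natCast_lcm_dvd_iff _ _ _).2 ⟨hdd i, hee i⟩⟩, hP⟩
    · rintro ⟨⟨hW, hl⟩, hP⟩
      exact ⟨hP, hW, fun i => ((natCast_lcm_dvd_iff _ _ _).1 (hl i)).1,
        fun i => ((natCast_lcm_dvd_iff _ _ _).1 (hl i)).2⟩
  rw [hset, card_filter_periodic_eq_sum_classes (dyadZ X) hq _ Q hper]
  rfl

/-! ### `φ_L` is multiplicative on coprime arguments -/

/-- `φ(a m n) φ(a) = φ(a m) φ(a n)` for `(m, n) = 1` (all arguments non-zero).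
[cite: FordGreenKonyaginMaynardTao2018, §7 p. 20 (φ_L multiplicative)] -/
theorem cast_totient_mul_mul (a m n : ℕ) (ha : a ≠ 0) (hm : m ≠ 0) (hn : n ≠ 0) (hmn : m.Coprime n) :
    (Nat.totient (a * (m * n)) : ℝ) * Nat.totient a = Nat.totient (a * m) * Nat.totient (a * n) := by
  classical
  rw [LFunctions.Zhang2022.totient_eq_mul_prod_real, LFunctions.Zhang2022.totient_eq_mul_prod_real a, LFunctions.Zhang2022.totient_eq_mul_prod_real (a * m),
    LFunctions.Zhang2022.totient_eq_mul_prod_real (a * n), Nat.primeFactors_mul ha (mul_ne_zero hm hn),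
    Nat.primeFactors_mul hm hn, Nat.primeFactors_mul ha hm, Nat.primeFactors_mul ha hn]
  set A := a.primeFactors
  set M := m.primeFactors
  set N := n.primeFactors
  have hMN : Disjoint M N := hmn.disjoint_primeFactors
  set g : ℕ → ℝ := fun p => 1 - 1 / (p : ℝ)
  have hU : A ∪ (M ∪ N) = (A ∪ M) ∪ (A ∪ N) := by
    ext p; simp only [Finset.mem_union]; tauto
  have hI : (A ∪ M) ∩ (A ∪ N) = A := by
    ext p
    simp only [Finset.mem_inter, Finset.mem_union]
    constructor
    · rintro ⟨h1 | h1, h2 | h2⟩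
      · exact h1
      · exact h1
      · exact h2
      · exact (Finset.disjoint_left.1 hMN h1 h2).elim
    · intro h; exact ⟨Or.inl h, Or.inl h⟩
  have key : (∏ p ∈ A ∪ (M ∪ N), g p) * ∏ p ∈ A, g p = (∏ p ∈ A ∪ M, g p) * ∏ p ∈ A ∪ N, g p := by
    have h0 := Finset.prod_union_inter (s₁ := A ∪ M) (s₂ := A ∪ N) (f := g)
    rw [← hU, hI] at h0
    exact h0
  push_cast
  calc (a : ℝ) * (m * n) * (∏ p ∈ A ∪ (M ∪ N), g p) * (a * ∏ p ∈ A, g p)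
      = (a : ℝ) * a * m * n * ((∏ p ∈ A ∪ (M ∪ N), g p) * ∏ p ∈ A, g p) := by ring
    _ = (a : ℝ) * a * m * n * ((∏ p ∈ A ∪ M, g p) * ∏ p ∈ A ∪ N, g p) := by rw [key]
    _ = (a : ℝ) * m * (∏ p ∈ A ∪ M, g p) * (a * n * ∏ p ∈ A ∪ N, g p) := by ring

/-- `φ_L(q) > 0` for `a_L ≠ 0`, `q ≠ 0`. [cite: FordGreenKonyaginMaynardTao2018, §7 p. 20 (φ_L)] -/
theorem totForm_pos (l : ℤ × ℤ) (hl : l.1 ≠ 0) {q : ℕ} (hq : q ≠ 0) : 0 < totForm l q := by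
  unfold totForm
  have h1 : 0 < Nat.totient l.1.natAbs := Nat.totient_pos.2 (Int.natAbs_pos.2 hl)
  have h2 : 0 < Nat.totient (l.1.natAbs * q) :=
    Nat.totient_pos.2 (Nat.mul_pos (Int.natAbs_pos.2 hl) (Nat.pos_of_ne_zero hq))
  have h1' : (0 : ℝ) < Nat.totient l.1.natAbs := by exact_mod_cast h1
  have h2' : (0 : ℝ) < Nat.totient (l.1.natAbs * q) := by exact_mod_cast h2
  positivity

/-- **`φ_L(mn) = φ_L(m) φ_L(n)` for `(m, n) = 1`** (`φ_L(q) = φ(|a| q)/φ(|a|)`, `a = a_L ≠ 0`).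
[cite: FordGreenKonyaginMaynardTao2018, §7 p. 20 (φ_L is multiplicative); Maynard2016DenseClusters, §7 p. 13 («φ_L»)] -/
theorem totForm_mul_of_coprime (l : ℤ × ℤ) (hl : l.1 ≠ 0) {m n : ℕ} (hm : m ≠ 0) (hn : n ≠ 0)
    (hmn : m.Coprime n) : totForm l (m * n) = totForm l m * totForm l n := by
  unfold totForm
  have ha : l.1.natAbs ≠ 0 := Int.natAbs_ne_zero.2 hl
  have hφ : (Nat.totient l.1.natAbs : ℝ) ≠ 0 := by
    exact_mod_cast (Nat.totient_pos.2 (Nat.pos_of_ne_zero ha)).ne'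
  have key := cast_totient_mul_mul l.1.natAbs m n ha hm hn hmn
  field_simp
  linear_combination key

/-! ### The expansion of `∑_n 1_𝒫(L_m(n)) w_n` over the classes -/

/-- The count of a pair vanishes unless both `d, e ∈ 𝒟'_k ∩ {d_m = 1}` (given `L_m(n) > R` on `𝒜(X)`).
[cite: Maynard2016DenseClusters, proof of Prop. 9.2 p. 21 («no contribution …», «iff d_m = e_m = 1»)] -/
theorem card_prime_pair_eq_zero_of_not_mem (X : ℝ) {L : Fin k → ℤ × ℤ} (hadm : FormsAdmissible L)
    {B : ℕ} {R : ℝ} (m : Fin k) (hR : ∀ n ∈ dyadZ X, R < (formEval (L m) n : ℝ))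
    {d e : Fin k → ℕ} (hd : d ∈ dkBox L B R) (he : e ∈ dkBox L B R)
    (hnot : ¬ (d ∈ dkBoxP L B R m ∧ e ∈ dkBoxP L B R m)) :
    #(((dyadZ X).filter fun n => 0 < formEval (L m) n ∧ (formEval (L m) n).natAbs.Prime).filter
        fun n => (∀ i, Int.gcd (formEval (L i) n) (wCut k B) = 1) ∧
          (∀ i, ((d i : ℕ) : ℤ) ∣ formEval (L i) n) ∧ ∀ i, ((e i : ℕ) : ℤ) ∣ formEval (L i) n) = 0 := by
  classical
  refine Finset.card_eq_zero.2 (Finset.filter_eq_empty_iff.2 fun n hn hsys => hnot ?_)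
  obtain ⟨hnA, hℓ, hprime⟩ := Finset.mem_filter.1 hn
  exact ⟨mem_dkBoxP_of_dvd_prime hadm hd hℓ hprime (hR n hnA) hsys.2.1,
    mem_dkBoxP_of_dvd_prime hadm he hℓ hprime (hR n hnA) hsys.2.2⟩

/-- The count of a pair `d, e ∈ 𝒟_k` as a class sum (`0` for a pair that is not cross-coprime).
[cite: Maynard2016DenseClusters, proof of Prop. 9.2 p. 21 (displays (9.6)–(9.8))] -/
theorem cast_card_prime_pair_eq_ite (X : ℝ) {L : Fin k → ℤ × ℤ} (hadm : FormsAdmissible L) {B : ℕ}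
    {R : ℝ} (m : Fin k) {d e : Fin k → ℕ} (hd : d ∈ dkBox L B R) (he : e ∈ dkBox L B R) :
    (#(((dyadZ X).filter fun n => 0 < formEval (L m) n ∧ (formEval (L m) n).natAbs.Prime).filter
        fun n => (∀ i, Int.gcd (formEval (L i) n) (wCut k B) = 1) ∧
          (∀ i, ((d i : ℕ) : ℤ) ∣ formEval (L i) n) ∧ ∀ i, ((e i : ℕ) : ℤ) ∣ formEval (L i) n) : ℝ) =
      if ∀ i j, i ≠ j → (d i * e i).Coprime (d j * e j) then
        ∑ c ∈ pairClasses L B d e, (primeCountZMod (L m) X (pairMod B d e) c : ℝ)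
      else 0 := by
  classical
  by_cases hcross : ∀ i j, i ≠ j → (d i * e i).Coprime (d j * e j)
  · rw [if_pos hcross, card_prime_pair_eq_sum_classes X L m hd he]; push_cast; rfl
  · have hP : ¬ Pairwise fun i j => (d i * e i).Coprime (d j * e j) :=
      fun hP => hcross fun i j hij => hP hij
    rw [if_neg hcross, card_pair_filter_eq_zero _ hadm hd he hP, Nat.cast_zero]

/-- **Expansion with the support restriction**: `∑_{n ∈ 𝒜(X)} 1_𝒫(L_m(n)) w_n =
∑'_{d, e ∈ 𝒟'_k, d_m = e_m = 1} λ_d λ_e ∑_{c ∈ classes(d,e)} #𝒫_{L_m}(X; q_{d,e}, c)`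
(cross-coprime pairs only). [cite: Maynard2016DenseClusters, proof of Prop. 9.2 p. 21, displays (9.6)–(9.8)] -/
theorem sum_prime_sieveWt_eq_classes (X : ℝ) {L : Fin k → ℤ × ℤ} (hadm : FormsAdmissible L) (B : ℕ)
    {R : ℝ} (F : (Fin k → ℝ) → ℝ) (m : Fin k) (hR : ∀ n ∈ dyadZ X, R < (formEval (L m) n : ℝ)) :
    ∑ n ∈ (dyadZ X).filter (fun n => 0 < formEval (L m) n ∧ (formEval (L m) n).natAbs.Prime),
        sieveWt L B R F n =
      ∑ d ∈ dkBoxP L B R m, ∑ e ∈ dkBoxP L B R m,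
        if ∀ i j, i ≠ j → (d i * e i).Coprime (d j * e j) then
          lamVar L B R F d * lamVar L B R F e *
            ∑ c ∈ pairClasses L B d e, (primeCountZMod (L m) X (pairMod B d e) c : ℝ)
        else 0 := by
  classical
  rw [sum_sieveWt_eq L B R F]
  have hsub := dkBoxP_subset L B R m
  -- restrict the inner sums to `dkBoxP`
  have hinner : ∀ d ∈ dkBox L B R,
      ∑ e ∈ dkBoxP L B R m, lamVar L B R F d * lamVar L B R F e *
          (#(((dyadZ X).filter fun n => 0 < formEval (L m) n ∧ (formEval (L m) n).natAbs.Prime).filter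
            fun n => (∀ i, Int.gcd (formEval (L i) n) (wCut k B) = 1) ∧
              (∀ i, ((d i : ℕ) : ℤ) ∣ formEval (L i) n) ∧ ∀ i, ((e i : ℕ) : ℤ) ∣ formEval (L i) n) : ℝ) =
        ∑ e ∈ dkBox L B R, lamVar L B R F d * lamVar L B R F e *
          (#(((dyadZ X).filter fun n => 0 < formEval (L m) n ∧ (formEval (L m) n).natAbs.Prime).filter
            fun n => (∀ i, Int.gcd (formEval (L i) n) (wCut k B) = 1) ∧
              (∀ i, ((d i : ℕ) : ℤ) ∣ formEval (L i) n) ∧ ∀ i, ((e i : ℕ) : ℤ) ∣ formEval (L i) n) : ℝ) :=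
    fun d hd => Finset.sum_subset hsub fun e he hen => by
      rw [card_prime_pair_eq_zero_of_not_mem X hadm m hR hd he (fun h => hen h.2), Nat.cast_zero,
        mul_zero]
  -- restrict the outer sum to `dkBoxP`
  have houter : ∑ d ∈ dkBoxP L B R m, ∑ e ∈ dkBox L B R, lamVar L B R F d * lamVar L B R F e *
          (#(((dyadZ X).filter fun n => 0 < formEval (L m) n ∧ (formEval (L m) n).natAbs.Prime).filter
            fun n => (∀ i, Int.gcd (formEval (L i) n) (wCut k B) = 1) ∧
              (∀ i, ((d i : ℕ) : ℤ) ∣ formEval (L i) n) ∧ ∀ i, ((e i : ℕ) : ℤ) ∣ formEval (L i) n) : ℝ) =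
        ∑ d ∈ dkBox L B R, ∑ e ∈ dkBox L B R, lamVar L B R F d * lamVar L B R F e *
          (#(((dyadZ X).filter fun n => 0 < formEval (L m) n ∧ (formEval (L m) n).natAbs.Prime).filter
            fun n => (∀ i, Int.gcd (formEval (L i) n) (wCut k B) = 1) ∧
              (∀ i, ((d i : ℕ) : ℤ) ∣ formEval (L i) n) ∧ ∀ i, ((e i : ℕ) : ℤ) ∣ formEval (L i) n) : ℝ) :=
    Finset.sum_subset hsub fun d hd hdn => Finset.sum_eq_zero fun e he => by
      rw [card_prime_pair_eq_zero_of_not_mem X hadm m hR hd he (fun h => hdn h.1), Nat.cast_zero,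
        mul_zero]
  rw [← houter]
  refine Finset.sum_congr rfl fun d hd => ?_
  rw [← hinner d (hsub hd)]
  refine Finset.sum_congr rfl fun e he => ?_
  rw [cast_card_prime_pair_eq_ite X hadm m (hsub hd) (hsub he)]
  split_ifs <;> simp

/-- **The exact main + error split of the proof of Prop. 9.2** (p. 21, after display (9.9)):
`∑_{n ∈ 𝒜(X)} 1_𝒫(L_m(n)) w_n = φ_ω(W) (#𝒫_{L_m}(X)/φ_{L_m}(W)) Q_m
  + ∑'_{d,e ∈ 𝒟'_k, d_m=e_m=1} λ_d λ_e ∑_{c ∈ classes(d,e)} (#𝒫_{L_m}(X; q, c) − #𝒫_{L_m}(X)/φ_{L_m}(q))`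
(`q = W∏[d_i,e_i]`, `φ_L(q) = φ_L(W) φ_L(∏[d_i,e_i])`, exactly `φ_ω(W)` classes).
[cite: Maynard2016DenseClusters, proof of Prop. 9.2 p. 21 («#𝒫_{L,𝒜}(x;q,a) = #𝒫_{L,𝒜}(x)/φ_L(q) + O(E_q^{(2)})», display (9.9))] -/
theorem sum_prime_sieveWt_eq_main_add_error (X : ℝ) {L : Fin k → ℤ × ℤ} (hadm : FormsAdmissible L)
    (B : ℕ) {R : ℝ} (F : (Fin k → ℝ) → ℝ) (m : Fin k)
    (hR : ∀ n ∈ dyadZ X, R < (formEval (L m) n : ℝ)) :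
    ∑ n ∈ (dyadZ X).filter (fun n => 0 < formEval (L m) n ∧ (formEval (L m) n).natAbs.Prime),
        sieveWt L B R F n =
      phiOmega L (wCut k B) * primeCountZ (L m) X / totForm (L m) (wCut k B) * primeQF L B R F m +
        ∑ d ∈ dkBoxP L B R m, ∑ e ∈ dkBoxP L B R m,
          if ∀ i j, i ≠ j → (d i * e i).Coprime (d j * e j) then
            lamVar L B R F d * lamVar L B R F e *
              ∑ c ∈ pairClasses L B d e, ((primeCountZMod (L m) X (pairMod B d e) c : ℝ) -
                primeCountZ (L m) X / totForm (L m) (pairMod B d e))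
          else 0 := by
  classical
  rw [sum_prime_sieveWt_eq_classes X hadm B F m hR]
  unfold primeQF
  rw [Finset.mul_sum, ← Finset.sum_add_distrib]
  refine Finset.sum_congr rfl fun d hd => ?_
  rw [Finset.mul_sum, ← Finset.sum_add_distrib]
  refine Finset.sum_congr rfl fun e he => ?_
  have hdB := dkBoxP_subset L B R m hd
  have heB := dkBoxP_subset L B R m he
  split_ifs with hcross
  · have hP : Pairwise fun i j => (d i * e i).Coprime (d j * e j) := fun i j hij => hcross i j hij
    have hcard := card_pairClasses_eq hadm hdB heB hP
    have ha : (L m).1 ≠ 0 := hadm.1 m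
    have hW0 : wCut k B ≠ 0 := (squarefree_wCut k B).ne_zero
    have hq0 : ∏ i, Nat.lcm (d i) (e i) ≠ 0 := Finset.prod_ne_zero_iff.2 fun i _ =>
      Nat.lcm_ne_zero (Nat.one_le_iff_ne_zero.1 (one_le_of_mem_dkBox hdB i))
        (Nat.one_le_iff_ne_zero.1 (one_le_of_mem_dkBox heB i))
    have hmW : ∀ ι, (Nat.lcm (d ι) (e ι)).Coprime (wCut k B) := fun ι =>
      Nat.Coprime.coprime_dvd_left (Nat.lcm_dvd_mul _ _)
        (Nat.Coprime.mul_left (coprime_apply_wCut_of_mem_dkBox hdB ι)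
          (coprime_apply_wCut_of_mem_dkBox heB ι))
    have hcop : (wCut k B).Coprime (∏ i, Nat.lcm (d i) (e i)) :=
      Nat.Coprime.prod_right fun i _ => (hmW i).symm
    have htot : totForm (L m) (pairMod B d e) =
        totForm (L m) (wCut k B) * totForm (L m) (∏ i, Nat.lcm (d i) (e i)) :=
      totForm_mul_of_coprime (L m) ha hW0 hq0 hcop
    have ht1 : totForm (L m) (wCut k B) ≠ 0 := (totForm_pos (L m) ha hW0).ne'
    have ht2 : totForm (L m) (∏ i, Nat.lcm (d i) (e i)) ≠ 0 := (totForm_pos (L m) ha hq0).ne'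
    rw [Finset.sum_sub_distrib, Finset.sum_const, nsmul_eq_mul, hcard, htot]
    field_simp
    ring
  · simp

end Literature.NumberTheory.Sieve.FGKMT2018
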